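import Literature.Barriers.CriticalPhenomena.LaceExpansionXSpaceLemma16NLoop
import HarnessLib

/-!
# Fitzner–van der Hofstad's numerical triangle bounds at `p_c` for `d ≥ 11`:
# `T_{p_c} ≤ 0.28036`, `T̄^{(0,0)}_{p_c} ≤ 0.53562` (EJP 2017, §7, (7.1)) — the computer-assisted
# input of Hara's `x`-space analysis in `11 ≤ d`, as ONE named fact, with its first consequences

Barrier catalogue `Literature/Barriers/CriticalPhenomena/` (D-0021), companion of
`LaceExpansionXSpaceLemma16.lean`, `LaceExpansionXSpacePsiBounds.lean` and
`LaceExpansionXSpaceLemma16NLoop.lean`. Every percolation fact of Hara's `x`-space analysis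
vendored in this catalogue (`Hara2008_lemma15Pc`, `Hara2008_lemma16Pc`, `Hara2008_lemma17Pc`,
`Hara2008_weightedNLoopBoundPc`, `HvdH2017_piNDiagramBoundPc` — through its summability
hypothesis —, `Hara2008_etaZeroXSpace`) carries the scope `11 ≤ d`, and in that range the
smallness of the lace-expansion diagrams at `p_c` ("`λ` sufficiently small", Hara 2008, Prop. 1.2
and Lemma 1.6; complete in print "only … for large `d` (say `d ≥ 30`)", §1.2) is in print a
NUMERICAL statement: Fitzner–van der Hofstad 2017, §7, proof of Thm. 1.4 — "we use that, by
our numerical computations in dimension `d = 11`,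

  (7.1) `T̄^{(0,0)} = sup_{x ∈ ℤ^d} (τ_{p_c}^{⋆3}(x) - δ_{0,x}) ≤ 0.53562`,
        `T_{p_c} = 2d p_c sup_{x ∈ ℤ^d} (τ_{p_c}^{⋆3} ⋆ D)(x) ≤ 0.28036`" —

and proof of Thm. 1.5 — "`Π̂^{(N)}_{p_c}(0) ≤ T'_{p_c}[2T_{p_c}T'_{p_c}]^{N-1}`, where
`T'_p = max_x (τ_p ⋆ τ_p ⋆ τ_p)(x) ≤ 1 + T̄^{(0,0)}` … it suffices to show that
`T_{p_c}(1 + 2T̄^{(0,0)}) < 1`, which we have already proved above". The numbers are the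
output of the non-backtracking lace expansion (NoBLE): the bootstrap of Fitzner–van der
Hofstad 2017, Prop. 2.4 (in this tree the named fact `FitznerVanDerHofstad2017_prop24`, which
is existential in its constants and does not carry the numbers) evaluated in the authors'
Mathematica notebooks (§2.5: "112 of such integrals", "Running these programs takes several
hours"; [FitHof13b], §6, "Model-dependent and computer-assisted verifications using
Mathematica"). Both theorems are stated for every `d ≥ d_min = 11`; the passage from the
`d = 11` computation to `d ≥ 12` is the monotonicity of all NoBLE bounds in the dimension
([FitHof13b], §2.5: "Since the bounds are monotone in the dimension, the bounds then also follow
for all dimensions larger than that specific dimension"; §6: "use monotonicity in the dimension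
`d` to obtain the result for all dimensions larger than the specified dimension"), exactly as
for `FitznerVanDerHofstad2017_prop24`.

This file isolates that input ONCE, in the vocabulary of `LaceExpansionXSpacePsiBounds.lean` /
`LaceExpansionXSpaceLemma16NLoop.lean`, where `T_{p_c} = Δ̃_{p_c} = percTriTildeBar d`
(`Δ̃_{p_c}(x) = (τ ⋆ τ ⋆ τ̃)(x)`, `τ̃ = 2dp_c D ⋆ τ`, Heydenreich–van der Hofstad (7.2.2)–(7.2.4)) and
`T̄^{(0,0)}_{p_c} = percTriBar00 d` (`sup_x (τ^{⋆3}(x) - δ_{0,x})`):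

* NAMED FACT `FitznerVanDerHofstad2017_triangleBoundsPc` — for every `d ≥ 11`,
  `percTriTildeBar d ≤ 0.28036` and `percTriBar00 d ≤ 0.53562`. A COMPUTER-ASSISTED result
  (certified numerics over an unformalised expansion): it is vendored to be CITED, not proved;
  no declaration of this tree evaluates either side.
* PROVED from it, for every `d ≥ 11`: `Δ_{p_c} ≤ 1.53562` (`percTriBar_le`), the finiteness of
  `Δ_{p_c}`, `Δ̃_{p_c}`, the classical rate `2Δ̃_{p_c}Δ_{p_c} < 1` (`two_mul_percTriTildeBar_mul_percTriBar_lt_one`;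
  numerically `2 · 0.28036 · 1.53562 = 0.86105…`), the summability of the Hara–Slade diagrams
  `Σ_N Σ_x piNDiagramPc d N x < ∞` (`tsum_tsum_piNDiagramPc_ne_top` — the hypothesis of
  `HvdH2017_piNDiagramBoundPc`), and the `β = γ = 0` case of `Hara2008_weightedNLoopBoundPc`
  (`weightedNLoopBound_zero_zero`, from `weightedNLoopBound_zero_zero_of_triangle_le`).

What it does NOT give by itself: `Hara2008_weightedNLoopBoundPc` for `β + γ > 0` (Hara's §3.4,
Steps 1–2: the distribution of `|x|^{β+γ}` over the two disjoint paths and the weighted blocks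
`W̄^{(β,γ)}`, `W̄^{(β,0)} T̄^{(0,γ)}`, `H̄^{(β)} T̄^{(0,γ)}` — pen-and-paper, on the kernel algebra of
`LaceExpansionXSpaceKernelNorms.lean` / `LaceExpansionXSpaceChains.lean`), nor Hara's sharper
condition `T_{p_c}(1 + 2T̄^{(0,0)}) < 1` ((7.2), "a recent improvement of the bounds by Hara",
unpublished: Acknowledgements), which this catalogue does not need — the printed organisation of
Heydenreich–van der Hofstad, Prop. 7.4, has rate `2T_{p_c}T'_{p_c} ≤ 2 · 0.28036 · 1.53562 < 1`.
The bound `p_c(11) ≤ 0.048242` (Thm. 1.2, table) is not restated.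

## References

* R. Fitzner, R. van der Hofstad, *Mean-field behavior for nearest-neighbor percolation in
  `d > 10`*, Electron. J. Probab. 22 (2017) no. 43 (arXiv:1506.07977): Thm. 1.4, Thm. 1.5 (both for
  `d ≥ d_min = 11`), §2.5 (the notebooks; "112 of such integrals"), §7, proof of Thm. 1.4 ((7.1),
  (7.2)) and proof of Thm. 1.5 (`Π̂^{(N)}_{p_c}(0) ≤ T'_{p_c}[2T_{p_c}T'_{p_c}]^{N-1}`,
  `T'_p ≤ 1 + T̄^{(0,0)}`), Acknowledgements.
* R. Fitzner, R. van der Hofstad, *Generalized approach to the non-backtracking lace expansion*,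
  Probab. Theory Related Fields 169 (2017) 1041–1119 (arXiv:1506.07969, [FitHof13b]): §2.5
  (Discussion: structure of the proof, Fig. 2, part (d); "monotone in the dimension"), §6
  (computer-assisted verification using Mathematica; "SRW.nb take around an hour").
* M. Heydenreich, R. van der Hofstad, *Progress in High-Dimensional Percolation and Random
  Graphs*, Springer 2017: (7.2.1)–(7.2.4), Prop. 7.4 ((7.5.3)) and the remark after it.
* T. Hara, Ann. Probab. 36 (2008) 530–593 (arXiv:math-ph/0504021): §1.2, Prop. 1.2, Lemma 1.6, §3.4.
-/

noncomputable section

namespace Literature.Barriers.CriticalPhenomena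

open _root_.MeasureTheory _root_.Filter Literature.Probability.LatticeModels
  Literature.Probability.Percolation

open scoped ENNReal

variable {d : ℕ}

/-! ### The numerical input (7.1) as a named fact -/

/-- NAMED FACT — **Fitzner–van der Hofstad's numerical triangle bounds at `p_c`, `d ≥ 11`**:
"by our numerical computations in dimension `d = 11`,
`T̄^{(0,0)} = sup_{x ∈ ℤ^d} (τ_{p_c}^{⋆3}(x) - δ_{0,x}) ≤ 0.53562`,
`T_{p_c} = 2d p_c sup_{x ∈ ℤ^d} (τ_{p_c}^{⋆3} ⋆ D)(x) ≤ 0.28036`" (§7, (7.1), in the proofs of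
Thms. 1.4 and 1.5, both stated for all `d ≥ d_min = 11`; for `d ≥ 12` by the monotonicity of the
NoBLE bounds in the dimension, [FitHof13b] §2.5 and §6). Here `T_{p_c} = percTriTildeBar d`
(`= sup_x (τ ⋆ τ ⋆ τ̃)(x)`, `τ̃ = 2dp_c D ⋆ τ_{p_c}`) and `T̄^{(0,0)} = percTriBar00 d`.
COMPUTER-ASSISTED (the NoBLE bootstrap, Prop. 2.4, evaluated in the authors' Mathematica
notebooks, §2.5): vendored as a cited input, not as a theorem of this tree; nothing here
evaluates it. Scope caveat: the two numbers are printed for `d = 11` only; no number is printed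
for `d ≥ 12`, where the statement rests on the cited monotonicity-in-`d` sentence. Users take
`(h : FitznerVanDerHofstad2017_triangleBoundsPc)`.
[cite: FitznerVanDerHofstad2017, §7 (7.1) (proof of Thm. 1.4) and proof of Thm. 1.5; Thms. 1.4–1.5 (d ≥ 11); §2.5]
[cite: FitznerVanDerHofstad2016NoBLE, §2.5 (Discussion, Fig. 2 part (d): monotone in the dimension) and §6 (computer-assisted verification)] -/
def FitznerVanDerHofstad2017_triangleBoundsPc : Prop :=
  ∀ d : ℕ, 11 ≤ d →
    percTriTildeBar d ≤ ENNReal.ofReal 0.28036 ∧ percTriBar00 d ≤ ENNReal.ofReal 0.53562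

namespace FitznerVanDerHofstad2017_triangleBoundsPc

/-- `T_{p_c} = Δ̃_{p_c} ≤ 0.28036` for `d ≥ 11`. [cite: FitznerVanDerHofstad2017, §7 (7.1)] -/
theorem percTriTildeBar_le (h : FitznerVanDerHofstad2017_triangleBoundsPc) (hd : 11 ≤ d) :
    percTriTildeBar d ≤ ENNReal.ofReal 0.28036 :=
  (h d hd).1

/-- `T̄^{(0,0)}_{p_c} ≤ 0.53562` for `d ≥ 11`. [cite: FitznerVanDerHofstad2017, §7 (7.1)] -/
theorem percTriBar00_le (h : FitznerVanDerHofstad2017_triangleBoundsPc) (hd : 11 ≤ d) :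
    percTriBar00 d ≤ ENNReal.ofReal 0.53562 :=
  (h d hd).2

/-- **`T'_{p_c} = Δ_{p_c} ≤ 1 + T̄^{(0,0)} ≤ 1.53562`** for `d ≥ 11`.
[cite: FitznerVanDerHofstad2017, §7 (proof of Thm. 1.5: T'_p ≤ 1 + T̄^{(0,0)}) and (7.1)] -/
theorem percTriBar_le (h : FitznerVanDerHofstad2017_triangleBoundsPc) (hd : 11 ≤ d) :
    percTriBar d ≤ ENNReal.ofReal 1.53562 :=
  calc percTriBar d ≤ 1 + percTriBar00 d := percTriBar_le_one_add_percTriBar00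
    _ ≤ 1 + ENNReal.ofReal 0.53562 := add_le_add le_rfl (h.percTriBar00_le hd)
    _ = ENNReal.ofReal 1.53562 := by
        rw [← ENNReal.ofReal_one, ← ENNReal.ofReal_add zero_le_one (by norm_num)]
        norm_num

/-- `Δ_{p_c} < ∞` for `d ≥ 11`. [cite: FitznerVanDerHofstad2017, §7 (7.1)] -/
theorem percTriBar_lt_top (h : FitznerVanDerHofstad2017_triangleBoundsPc) (hd : 11 ≤ d) :
    percTriBar d < ⊤ :=
  lt_of_le_of_lt (h.percTriBar_le hd) ENNReal.ofReal_lt_top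

/-- `Δ̃_{p_c} < ∞` for `d ≥ 11`. [cite: FitznerVanDerHofstad2017, §7 (7.1)] -/
theorem percTriTildeBar_lt_top (h : FitznerVanDerHofstad2017_triangleBoundsPc) (hd : 11 ≤ d) :
    percTriTildeBar d < ⊤ :=
  lt_of_le_of_lt (h.percTriTildeBar_le hd) ENNReal.ofReal_lt_top

/-- **The classical rate is `< 1`**: `2Δ̃_{p_c}Δ_{p_c} ≤ 2 · 0.28036 · 1.53562 < 1` for `d ≥ 11`
("`Π̂^{(N)}_{p_c}(0) ≤ T'_{p_c}[2T_{p_c}T'_{p_c}]^{N-1}`"; Heydenreich–van der Hofstad: "we need that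
`2Δ̃_pΔ_p < 1` in order for the geometric sum (over `N`) to converge").
[cite: FitznerVanDerHofstad2017, §7 (proof of Thm. 1.5) and (7.1)]
[cite: HeydenreichVanDerHofstad2017, Prop. 7.4 and the remark after it] -/
theorem two_mul_percTriTildeBar_mul_percTriBar_lt_one (h : FitznerVanDerHofstad2017_triangleBoundsPc)
    (hd : 11 ≤ d) : 2 * percTriTildeBar d * percTriBar d < 1 :=
  calc 2 * percTriTildeBar d * percTriBar d
      ≤ 2 * ENNReal.ofReal 0.28036 * ENNReal.ofReal 1.53562 := by
        gcongr
        · exact h.percTriTildeBar_le hd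
        · exact h.percTriBar_le hd
    _ = ENNReal.ofReal (2 * 0.28036 * 1.53562) := by
        rw [ENNReal.ofReal_mul (by norm_num), ENNReal.ofReal_mul zero_le_two, ENNReal.ofReal_ofNat]
    _ < 1 := by
        rw [← ENNReal.ofReal_one]
        exact (ENNReal.ofReal_lt_ofReal_iff zero_lt_one).2 (by norm_num)

/-- The `N = 0` diagrams are summable whenever `Δ_{p_c} < ∞`:
`Σ_x (τ(x)² - δ_{0,x}) ≤ Σ_x τ(x) τ(-x) ≤ Δ_{p_c}(0) ≤ Δ_{p_c}` (the terms `y = x, z = 0` of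
`Δ_{p_c}(0) = Σ_{y,z} τ(y) τ(z - y) τ(-z)`). [folklore] -/
theorem tsum_piNDiagramPc_zero_le_percTriBar : ∑' x : Site d, piNDiagramPc d 0 x ≤ percTriBar d := by
  calc ∑' x : Site d, piNDiagramPc d 0 x
      ≤ ∑' x : Site d, tauPcE d x * tauPcE d (0 - x) * tauPcE d (0 - 0) := by
        refine ENNReal.tsum_le_tsum fun x => ?_
        rw [piNDiagramPc_zero, sub_zero, tauPcE_zero, mul_one, zero_sub, tauPcE_neg, tauPcE,
          ← ENNReal.ofReal_mul (tau_nonneg _ _ _), ← pow_two]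
        exact ENNReal.ofReal_le_ofReal (sub_le_self _ (by split_ifs <;> norm_num))
    _ ≤ ∑' yz : Site d × Site d, tauPcE d yz.1 * tauPcE d (yz.2 - yz.1) * tauPcE d (0 - yz.2) :=
        ENNReal.tsum_comp_le_tsum_of_injective (f := fun x : Site d => (x, (0 : Site d)))
          (fun x y hxy => (Prod.mk.injEq _ _ _ _ ▸ hxy : x = y ∧ (0 : Site d) = 0).1)
          (fun yz : Site d × Site d => tauPcE d yz.1 * tauPcE d (yz.2 - yz.1) * tauPcE d (0 - yz.2))
    _ = percTri d 0 := rfl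
    _ ≤ percTriBar d := le_iSup (fun x => percTri d x) 0

/-- **Summability of the Hara–Slade diagrams at `p_c` for `d ≥ 11`** — the hypothesis
`Σ_N Σ_x piNDiagramPc d N x < ∞` of `HvdH2017_piNDiagramBoundPc`, from the numerical triangle
bounds: `N = 0` by `tsum_piNDiagramPc_zero_le_percTriBar`, `N ≥ 1` by the geometric sum
`Δ_{p_c} Σ_N (2Δ̃_{p_c}Δ_{p_c})^N` (`tsum_tsum_piNDiagramPc_succ_lt_top`).
[cite: FitznerVanDerHofstad2017, §2.6 ("the classical lace expansion actually also converges") and §7 (proof of Thm. 1.5)]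
[cite: HeydenreichVanDerHofstad2017, Prop. 7.4 ((7.5.3))] -/
theorem tsum_tsum_piNDiagramPc_ne_top (h : FitznerVanDerHofstad2017_triangleBoundsPc) (hd : 11 ≤ d) :
    (∑' N : ℕ, ∑' x : Site d, piNDiagramPc d N x) ≠ ⊤ := by
  rw [tsum_eq_zero_add' ENNReal.summable]
  refine (ENNReal.add_lt_top.2 ⟨?_, ?_⟩).ne
  · exact lt_of_le_of_lt tsum_piNDiagramPc_zero_le_percTriBar (h.percTriBar_lt_top hd)
  · exact tsum_tsum_piNDiagramPc_succ_lt_top (h.percTriBar_lt_top hd)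
      (h.two_mul_percTriTildeBar_mul_percTriBar_lt_one hd)

/-- **The `β = γ = 0` case of `Hara2008_weightedNLoopBoundPc` for every `d ≥ 11`** from the
numerical triangle bounds: `Σ_x piNDiagramPc d N x ≤ 1.53562 (N+1)² (0.86105…)^N`, `N ≥ 1`
(`weightedNLoopBound_zero_zero_of_triangle_le` with `a = 0.28036`, `b = 1.53562`).
[cite: FitznerVanDerHofstad2017, §7 ((7.1) and proof of Thm. 1.5)]
[cite: Hara2008, §3.4 (Step 3 and Summary)] -/
theorem weightedNLoopBound_zero_zero (h : FitznerVanDerHofstad2017_triangleBoundsPc) (hd : 11 ≤ d) :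
    ∃ c ρ : ℝ, 0 < ρ ∧ ρ < 1 ∧ ∀ N : ℕ, 1 ≤ N →
      ∑' x : Site d, ENNReal.ofReal (euclidNorm x ^ ((0 : ℝ) + 0)) * piNDiagramPc d N x ≤
        ENNReal.ofReal (c * ((N : ℝ) + 1) ^ (2 + (0 : ℝ) + 0) * ρ ^ N) :=
  weightedNLoopBound_zero_zero_of_triangle_le (by norm_num) (by norm_num) (h.percTriTildeBar_le hd)
    (h.percTriBar_le hd) (by norm_num)

end FitznerVanDerHofstad2017_triangleBoundsPc

end Literature.Barriers.CriticalPhenomena
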